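import Literature.AlgebraicGeometry.Frobenioids.PadicFrobenioidRationalData
import Literature.AlgebraicGeometry.Frobenioids.ModelFrobenioidPhiBirat
import Literature.AlgebraicGeometry.Frobenioids.ModelFrobenioidCofinal
import HarnessLib

/-!
# Frobenioids II, Theorem 1.2 (i), third sentence: every object of the `p`-adic Frobenioid is strictly rational
# (Def. 4.5 (ii) of [FrdI]) — PROOF

Mochizuki, *The geometry of Frobenioids II: poly-Frobenioids*, Kyushu J. Math. **62** (2008) 401–460, §1,
proof of Theorem 1.2 (i), kurims text p. 9: "since the image monoids of this homomorphism are assumed to be nonzero,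
and `Φ` is monoprime [cf. Example 1.1, (ii)], it follows immediately that `C` is of quasi-Frobenius-trivial and
[strictly] rational type, but not of group-like type. Thus, it follows immediately from [Mzk5], Theorem 5.2, (iii),
that if `D` is of FSMFF-type, then `C` is of rationally standard type." [cite: MochizukiFrdII2008, Thm 1.2 (i) p.9]

PROOF-ONLY (seat abc-iut-L6-t10 gen 2; L1-lead R75 (3) row M17, the "rational type" conjunct), over THE
birationalization `PreFrobenioid.biratData` of the `p`-adic model Frobenioid (`ModelFrobenioidPhiBirat.lean`:
`Φ^birat(A_D) = Div_B(B(A_D))`) and for ANY support predicate `Supp` obeying the support axiom `hSupp`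
("`𝔭 ∈ Supp(a)` iff some primary element of the class `𝔭` is `≼ a`"). PROVED:
* `PadicFrd.Datum.isStrictlyRational` — **every object is strictly rational**: by `Datum.exists_divB_eq_of` some
  `f ∈ B(A_D)` has `Div_B(f) = [c]` with `1 ≠ c ∈ Φ(A_D)`; take `a := c`, `b := 1`; every primary element is
  `≼ c` because a monoprime monoid is archimedean (`IsMonoprime.exists_dvd_pow`), and no primary element is `≼ 1`;
* `PadicFrd.Datum.isRational` — hence rational.
No definitions; nothing here bears on [IUTchIII] or asserts anything about abc.
-/

noncomputable section

namespace Literature.AlgebraicGeometry.Frobenioids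

open CategoryTheory Opposite Function

namespace PadicFrd

namespace Datum

universe v u

variable {D : Type u} [Category.{v} D] {p : ℕ} [Fact p.Prime] (d : Datum D p)

/-- **Thm. 1.2 (i), proof: "`C` is of … [strictly] rational type"** (FrdII p. 9) — PROVED at THE birationalization
of the `p`-adic model Frobenioid and for ANY support predicate satisfying the support axiom: every object is
strictly rational ([FrdI] Def. 4.5 (ii)). [cite: MochizukiFrdII2008, Thm 1.2 (i) p.9] -/
theorem isStrictlyRational (hF : PreFrobenioid.IsFrobenioid d.structureFunctor)
    (hsq : PreFrobenioid.HasBiratSquares d.structureFunctor)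
    (Supp : ∀ {X : D}, (ModelFrobenioid.data d.Φ d.B d.divB).Mon X →
      Primes ((ModelFrobenioid.data d.Φ d.B d.divB).Mon X) → Prop)
    (hSupp : ∀ (X : D) (a : d.Φ.obj (op X)) (𝔭 : Primes (d.Φ.obj (op X))),
      Supp a 𝔭 ↔ ∃ (a₀ : d.Φ.obj (op X)) (h₀ : IsPrimary a₀), Quotient.mk (primarySetoid _) ⟨a₀, h₀⟩ = 𝔭 ∧ Precsim a₀ a)
    (A : d.frobenioid) :
    PreFrobenioidData.IsStrictlyRational (PreFrobenioid.biratData hF hsq) Supp A := by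
  refine (ModelFrobenioid.isStrictlyRational_biratData_iff d.objectwise_isGroupLike_B
    (fun X => (d.isMonoprime (op X)).isDivisorial) hF hsq Supp A).mpr fun 𝔭 => ?_
  obtain ⟨⟨a₀, ha₀⟩, rfl⟩ := Quotient.exists_rep 𝔭
  obtain ⟨f, c, hc, hfc⟩ := d.exists_divB_eq_of (op A.base)
  refine ⟨c, 1, ⟨f, by rw [map_one, div_one, hfc]⟩, ?_, ?_⟩
  · -- every primary element is `≼ c` (monoprime ⇒ archimedean)
    obtain ⟨n, hn⟩ := (d.isMonoprime (op A.base)).exists_dvd_pow hc a₀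
    exact (hSupp A.base _ _).mpr ⟨a₀, ha₀, rfl, n + 1, Nat.succ_pos n, by rw [pow_succ]; exact Dvd.dvd.mul_right hn c⟩
  · -- no primary element is `≼ 1`
    rintro h1
    obtain ⟨a₁, ha₁, -, n, -, hdvd⟩ := (hSupp A.base _ _).mp h1
    rw [one_pow] at hdvd
    exact ha₁.1 ((d.isMonoprime (op A.base)).isSharp.1 a₁ (isUnit_of_dvd_one hdvd))

/-- Hence every object of the `p`-adic Frobenioid is RATIONAL ([FrdI] Def. 4.5 (ii)).
[cite: MochizukiFrdII2008, Thm 1.2 (i) p.9] -/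
theorem isRational (hF : PreFrobenioid.IsFrobenioid d.structureFunctor)
    (hsq : PreFrobenioid.HasBiratSquares d.structureFunctor)
    (Supp : ∀ {X : D}, (ModelFrobenioid.data d.Φ d.B d.divB).Mon X →
      Primes ((ModelFrobenioid.data d.Φ d.B d.divB).Mon X) → Prop)
    (hSupp : ∀ (X : D) (a : d.Φ.obj (op X)) (𝔭 : Primes (d.Φ.obj (op X))),
      Supp a 𝔭 ↔ ∃ (a₀ : d.Φ.obj (op X)) (h₀ : IsPrimary a₀), Quotient.mk (primarySetoid _) ⟨a₀, h₀⟩ = 𝔭 ∧ Precsim a₀ a)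
    (A : d.frobenioid) :
    PreFrobenioidData.IsRational (PreFrobenioid.biratData hF hsq) Supp A :=
  ⟨A, 𝟙 A, PreFrobenioidData.isPullbackMorphism_id _ A, d.isStrictlyRational hF hsq Supp hSupp A⟩

end Datum

end PadicFrd

end Literature.AlgebraicGeometry.Frobenioids

end
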